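import Summits.Ventures.LatticeQCDFlow.Exactness.IMHCoupledUnbiasedEstimatorUntruncated
import HarnessLib

/-!
# The central limit theorem for coupled flow-MCMC estimates: across independent coupled pairs the grand mean is asymptotically
# Gaussian — centred EXACTLY at `π f` for the untruncated estimator, at a point within `(1 − A)^{k+N}(c − a)` of `π f` for the
# truncated one — with a variance at most `Var_π f + (1 − A)^k(c − a)²(2W² + W + 1)`

HONEST FRAMING: exact (Metropolis-corrected) sampling algorithms for lattice gauge theory;
figures of merit are autocorrelation/cost numbers at stated couplings and volumes; no
continuum-physics claim.

Venture `LatticeQCDFlow` (cell pub-lqcd), topic `Exactness`; FANOUT row 30 (lean-1, GEN-38).  NEW WORK of the cell,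
general state space (`MeasurableEq Ω` for the untruncated estimator); sequel to GEN-37's `Exactness/IMHCoupledEstimatorReplicas`
(independent pair streams `Z_j` of the common-random-numbers pair chain `K̂` of `K = indepMH q w`, the truncated coupled estimator
`H_{k,N}(Z_j) = f(Y_k) + Σ_{n<N}(f(X′_{k+n}) − f(Y_{k+n}))`, `a ≤ f ≤ c` measurable) and to this generation's
`Exactness/IMHCoupledUnbiasedEstimatorUntruncated` (the untruncated `H_k = f(Y_k) + Σ_{n≥0}(…)` is in `L²` with
`E(H_k − π f)² ≤ Var_π f + r^k(c − a)²(2W² + W + 1)`, `W = w(x₀)`, `r = 1 − 1/W`, and `E H_k = π f` EXACTLY under the lag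
condition — GEN-36).  Mathlib's central limit theorem (`ProbabilityTheory.tendstoInDistribution_inv_sqrt_mul_sum_sub`, i.i.d.
square-integrable real variables) is APPLIED — nothing about it is restated or cited as a fact:

* §1 (truncated, every `N`) **`crnLag_replicas_identDistrib`**, **`crnLag_replicas_iIndepFun`** [bookkeeping];
  **`crnLag_replicas_clt`** — for mutually independent pair streams with the common law of the pair chain from ONE initial
  coupling `ν̂` one update ahead: `√R·(H̄_R − m_{k,N}) ⇒ N(0, Var H_{k,N})` in distribution as `R → ∞`, where
  `m_{k,N} = E f(Y_{k+N}) = (ν₂K^{k+N}) f` is the EXACT mean of one coupled estimate (GEN-37); **`crnLag_replica_mean_sub_abs_le`**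
  — `|m_{k,N} − π f| ≤ r^{k+N}(c − a)`; **`crnLag_replica_variance_le`** — `Var H_{k,N} ≤ Var_π f + r^k(c − a)²(2W² + W + 1)`.
* §2 (untruncated, `MeasurableEq Ω`) **`crnLag_untruncated_replicas_clt`** — `√R·(H̄_R − π f) ⇒ N(0, Var H_k)`: THE GAUSSIAN
  CONFIDENCE INTERVAL `H̄_R ± z·σ/√R` IS ASYMPTOTICALLY EXACT FOR `π f` ITSELF — no burn-in bias at any `R`, from every starting
  law, with (**`crnLag_untruncated_replica_variance_le`**) `σ² = Var H_k ≤ Var_π f + r^k(c − a)²(2W² + W + 1)`.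
* §3 **`crnLag_untruncated_replicas_strongLaw`** — `H̄_R → π f` ALMOST SURELY (Mathlib's `strong_law_ae` applied): the grand mean
  of coupled estimates is consistent for the target value itself, from every starting law.
Reading (gauge files): run independent coupled pairs of the exact gauge sampler from any start; the distribution of the grand
mean of the coupled estimates around the true target value is asymptotically normal with a variance at most one equilibrium
draw's plus `(1 − A)^k(c − a)²(2/A² + 1/A + 1)`, so standard Gaussian error bars apply to it without thermalisation.
NOT CLAIMED: a Berry–Esseen rate; the exact variance; a studentised statement (the printed `SE` in place of `σ` — this
generation's `IMHCoupledEstimatorErrorBar` gives `E[SE²]` exactly but not Slutsky); anything for unbounded `f` or any value of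
`A`.  No `sorry`, no new definitions, nothing cited as a fact.
-/

noncomputable section

namespace Summit.Ventures.LatticeQCDFlow.Exactness

open MeasureTheory ProbabilityTheory Function Finset Filter
open scoped ENNReal unitInterval Topology
open Summit.Ventures.LatticeQCDFlow.Scoring

variable {Ω : Type*} [MeasurableSpace Ω] {q : Measure Ω} [IsProbabilityMeasure q] {w : Ω → ℝ}

section Replicas

variable {Ω' : Type*} {mΩ' : MeasurableSpace Ω'} {μ : Measure Ω'} [IsProbabilityMeasure μ]
  {Z : ℕ → Ω' → (ℕ → Ω × Ω)} {P : Measure (ℕ → Ω × Ω)}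
  {Ω'' : Type*} {mΩ'' : MeasurableSpace Ω''} {P' : Measure Ω''} [IsProbabilityMeasure P'] {Y : Ω'' → ℝ}

/-! ## §1 The truncated estimator: asymptotically Gaussian about its exact mean -/

omit [IsProbabilityMeasure q] [IsProbabilityMeasure μ] in
/-- Pair streams with a common law give identically distributed values of every measurable statistic. [ours, bookkeeping] -/
theorem crnLag_replicas_identDistrib {φ : (ℕ → Ω × Ω) → ℝ} (hφ : Measurable φ) (hZm : ∀ j, Measurable (Z j))
    (hlaw : ∀ j, μ.map (Z j) = P) (j : ℕ) :
    IdentDistrib (fun ω => φ (Z j ω)) (fun ω => φ (Z 0 ω)) μ μ where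
  aemeasurable_fst := (hφ.comp (hZm j)).aemeasurable
  aemeasurable_snd := (hφ.comp (hZm 0)).aemeasurable
  map_eq := by
    change μ.map (φ ∘ Z j) = μ.map (φ ∘ Z 0)
    rw [← Measure.map_map hφ (hZm j), ← Measure.map_map hφ (hZm 0), hlaw j, hlaw 0]

omit [IsProbabilityMeasure q] [IsProbabilityMeasure μ] in
/-- Mutually independent pair streams give mutually independent values of every measurable statistic. [ours, bookkeeping] -/
theorem crnLag_replicas_iIndepFun {φ : (ℕ → Ω × Ω) → ℝ} (hφ : Measurable φ) (hind : iIndepFun Z μ) :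
    iIndepFun (fun j ω => φ (Z j ω)) μ :=
  hind.comp (fun _ => φ) fun _ => hφ

/-- **THE CENTRAL LIMIT THEOREM FOR COUPLED ESTIMATES (truncated).**  `w` measurable (a `Fact`), positive, normalised; `K̂` a CRN
pair kernel; `Z_0, Z_1, …` mutually independent pair streams on a probability space, each distributed as the pair chain from ONE
initial coupling `ν̂` one update ahead in its first coordinate; `a ≤ f ≤ c` measurable; `m_{k,N} = (ν₂K^{k+N}) f` the exact mean of
one coupled estimate.  Then `(√R)⁻¹·(Σ_{j<R} H_{k,N}(Z_j) − R·m_{k,N})` converges in distribution to `N(0, Var H_{k,N}(Z_0))`.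
[ours — Mathlib's CLT applied] -/
theorem crnLag_replicas_clt [Fact (Measurable w)] (hw0 : ∀ y, 0 < w y)
    (Khat : Kernel (Ω × Ω) (Ω × Ω)) [IsMarkovKernel Khat]
    (hK : ∀ z : Ω × Ω, Khat z = (q.prod (volume : Measure unitInterval)).map (fun p : Ω × unitInterval =>
      ((if (p.2 : ℝ) * w z.1 ≤ w p.1 then p.1 else z.1), (if (p.2 : ℝ) * w z.2 ≤ w p.1 then p.1 else z.2))))
    (ν : Measure (Ω × Ω)) [IsProbabilityMeasure ν] (hlag : ν.map Prod.fst = (ν.map Prod.snd).bind (indepMH q w))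
    {f : Ω → ℝ} (hf : Measurable f) {a c : ℝ} (ha : ∀ x, a ≤ f x) (hc : ∀ x, f x ≤ c) (k N : ℕ)
    (hZm : ∀ j, Measurable (Z j))
    (hlaw : ∀ j, μ.map (Z j) = Kernel.trajMeasure (X := fun _ : ℕ => Ω × Ω) ν
      (fun n : ℕ => Khat.comap (fun h : (i : ↥(Finset.Iic n)) → Ω × Ω => h ⟨n, Finset.mem_Iic.2 le_rfl⟩)
        (measurable_pi_apply _)))
    (hind : iIndepFun Z μ)
    (hY : HasLaw Y (gaussianReal 0
      (Var[fun ω => f ((Z 0 ω k).2) + ∑ n ∈ range N, (f ((Z 0 ω (k + n)).1) - f ((Z 0 ω (k + n)).2)); μ]).toNNReal) P') :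
    TendstoInDistribution
      (fun (R : ℕ) ω => (√(R : ℝ))⁻¹ *
        (∑ j ∈ range R, (f ((Z j ω k).2) + ∑ n ∈ range N, (f ((Z j ω (k + n)).1) - f ((Z j ω (k + n)).2))) -
          R * ∫ y, f y ∂((fun m : Measure Ω => m.bind (indepMH q w))^[k + N] (ν.map Prod.snd))))
      atTop Y (fun _ => μ) P' := by
  have hHm : Measurable fun z : ℕ → Ω × Ω => f ((z k).2) + ∑ n ∈ range N, (f ((z (k + n)).1) - f ((z (k + n)).2)) :=
    measurable_crnLagEstimator hf k N
  have hC : ∀ x, |f x| ≤ max |a| |c| := fun x => abs_le_max_abs_abs (ha x) (hc x)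
  have hX2 : MemLp (fun ω => f ((Z 0 ω k).2) + ∑ n ∈ range N, (f ((Z 0 ω (k + n)).1) - f ((Z 0 ω (k + n)).2))) 2 μ :=
    memLp_crnLag_replica hf ha hc k N hZm 0
  have hindep := crnLag_replicas_iIndepFun (μ := μ) hHm hind
  have hident := crnLag_replicas_identDistrib (μ := μ) hHm hZm hlaw
  have hmean : μ[fun ω => f ((Z 0 ω k).2) + ∑ n ∈ range N, (f ((Z 0 ω (k + n)).1) - f ((Z 0 ω (k + n)).2))] =
      ∫ y, f y ∂((fun m : Measure Ω => m.bind (indepMH q w))^[k + N] (ν.map Prod.snd)) := by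
    rw [integral_comp_eq_of_map_eq (hZm 0) (hlaw 0) hHm]
    exact crnLag_truncated_integral_eq hw0 Khat hK ν hlag hf hC k N
  have h := tendstoInDistribution_inv_sqrt_mul_sum_sub
    (X := fun j ω => f ((Z j ω k).2) + ∑ n ∈ range N, (f ((Z j ω (k + n)).1) - f ((Z j ω (k + n)).2))) hY hX2 hindep hident
  rw [hmean] at h
  exact h

/-- **The centring point is within `r^{k+N}(c − a)` of `π f`**: `|m_{k,N} − π f| ≤ r^{k+N}(c − a)` (`w` maximal at `x₀`). [ours] -/
theorem crnLag_replica_mean_sub_abs_le [Fact (Measurable w)] (hw0 : ∀ y, 0 < w y) {x₀ : Ω} (hmax : ∀ y, w y ≤ w x₀)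
    [IsProbabilityMeasure (q.withDensity fun y => ENNReal.ofReal (w y))]
    (ν : Measure (Ω × Ω)) [IsProbabilityMeasure ν] {f : Ω → ℝ} (hf : Measurable f) {a c : ℝ} (ha : ∀ x, a ≤ f x)
    (hc : ∀ x, f x ≤ c) (k N : ℕ) :
    |∫ y, f y ∂((fun m : Measure Ω => m.bind (indepMH q w))^[k + N] (ν.map Prod.snd)) -
        ∫ x, f x ∂(q.withDensity fun y => ENNReal.ofReal (w y))| ≤ (1 - (w x₀)⁻¹) ^ (k + N) * (c - a) := by
  haveI : IsProbabilityMeasure (ν.map Prod.snd) := Measure.isProbabilityMeasure_map measurable_snd.aemeasurable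
  exact integral_iterate_bind_indepMH_abs_le (q := q) Fact.out hw0 hmax (k + N) (ν.map Prod.snd) hf ha hc

/-- **The limiting variance is at most `Var_π f + r^k(c − a)²(2W² + W + 1)`**: `Var H_{k,N}(Z_0) ≤ E(H_{k,N}(Z_0) − π f)²`
bounded by GEN-37's second-moment certificate. [ours] -/
theorem crnLag_replica_variance_le [Fact (Measurable w)] (hw0 : ∀ y, 0 < w y) {x₀ : Ω} (hmax : ∀ y, w y ≤ w x₀)
    [IsProbabilityMeasure (q.withDensity fun y => ENNReal.ofReal (w y))]
    (Khat : Kernel (Ω × Ω) (Ω × Ω)) [IsMarkovKernel Khat]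
    (hK : ∀ z : Ω × Ω, Khat z = (q.prod (volume : Measure unitInterval)).map (fun p : Ω × unitInterval =>
      ((if (p.2 : ℝ) * w z.1 ≤ w p.1 then p.1 else z.1), (if (p.2 : ℝ) * w z.2 ≤ w p.1 then p.1 else z.2))))
    (ν : Measure (Ω × Ω)) [IsProbabilityMeasure ν] {f : Ω → ℝ} (hf : Measurable f) {a c : ℝ} (ha : ∀ x, a ≤ f x)
    (hc : ∀ x, f x ≤ c) (k N : ℕ) (hZm : ∀ j, Measurable (Z j))
    (hlaw : ∀ j, μ.map (Z j) = Kernel.trajMeasure (X := fun _ : ℕ => Ω × Ω) ν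
      (fun n : ℕ => Khat.comap (fun h : (i : ↥(Finset.Iic n)) → Ω × Ω => h ⟨n, Finset.mem_Iic.2 le_rfl⟩)
        (measurable_pi_apply _))) :
    Var[fun ω => f ((Z 0 ω k).2) + ∑ n ∈ range N, (f ((Z 0 ω (k + n)).1) - f ((Z 0 ω (k + n)).2)); μ] ≤
      ∫ y, (f y - ∫ x, f x ∂(q.withDensity fun y => ENNReal.ofReal (w y))) ^ 2
          ∂(q.withDensity fun y => ENNReal.ofReal (w y)) +
        (1 - (w x₀)⁻¹) ^ k * (c - a) ^ 2 * (2 * w x₀ ^ 2 + w x₀ + 1) := by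
  have hX2 : MemLp (fun ω => f ((Z 0 ω k).2) + ∑ n ∈ range N, (f ((Z 0 ω (k + n)).1) - f ((Z 0 ω (k + n)).2))) 2 μ :=
    memLp_crnLag_replica hf ha hc k N hZm 0
  have h1 := integral_sub_const_sq hX2 (∫ x, f x ∂(q.withDensity fun y => ENNReal.ofReal (w y)))
  have h2 := crnLag_replica_sq_le hw0 hmax Khat hK hf ha hc k N (ν₀ := fun _ => ν) hZm (hlaw 0)
  nlinarith [sq_nonneg (μ[fun ω => f ((Z 0 ω k).2) + ∑ n ∈ range N, (f ((Z 0 ω (k + n)).1) - f ((Z 0 ω (k + n)).2))] -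
    ∫ x, f x ∂(q.withDensity fun y => ENNReal.ofReal (w y)))]

/-! ## §2 The untruncated estimator: asymptotically Gaussian about `π f` itself -/

omit [IsProbabilityMeasure μ] in
/-- A replica of the untruncated estimator is in `L²`, transferred along the law. [ours, bookkeeping] -/
theorem memLp_crnLag_untruncated_replica [MeasurableEq Ω] [Fact (Measurable w)] (hw0 : ∀ y, 0 < w y) {x₀ : Ω}
    (hmax : ∀ y, w y ≤ w x₀) [IsProbabilityMeasure (q.withDensity fun y => ENNReal.ofReal (w y))]
    (Khat : Kernel (Ω × Ω) (Ω × Ω)) [IsMarkovKernel Khat]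
    (hK : ∀ z : Ω × Ω, Khat z = (q.prod (volume : Measure unitInterval)).map (fun p : Ω × unitInterval =>
      ((if (p.2 : ℝ) * w z.1 ≤ w p.1 then p.1 else z.1), (if (p.2 : ℝ) * w z.2 ≤ w p.1 then p.1 else z.2))))
    (ν : Measure (Ω × Ω)) [IsProbabilityMeasure ν] {f : Ω → ℝ} (hf : Measurable f) {a c : ℝ} (ha : ∀ x, a ≤ f x)
    (hc : ∀ x, f x ≤ c) (k : ℕ) (hZm : ∀ j, Measurable (Z j)) {j : ℕ}
    (hlaw : μ.map (Z j) = Kernel.trajMeasure (X := fun _ : ℕ => Ω × Ω) ν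
      (fun n : ℕ => Khat.comap (fun h : (i : ↥(Finset.Iic n)) → Ω × Ω => h ⟨n, Finset.mem_Iic.2 le_rfl⟩)
        (measurable_pi_apply _))) :
    MemLp (fun ω => f ((Z j ω k).2) + ∑' n, (f ((Z j ω (k + n)).1) - f ((Z j ω (k + n)).2))) 2 μ := by
  have h := crnLag_untruncated_memLp_two hw0 hmax Khat hK ν hf ha hc k
  rw [← hlaw] at h
  exact (memLp_map_measure_iff h.aestronglyMeasurable (hZm j).aemeasurable).1 h

omit [IsProbabilityMeasure μ] in
/-- The untruncated statistic of pair streams with the common law of the pair chain: a.e.-strongly measurable under each image law,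
identically distributed, and mutually independent when the streams are. [ours, bookkeeping] -/
theorem crnLag_untruncated_replicas_identDistrib [MeasurableEq Ω] [Fact (Measurable w)] (hw0 : ∀ y, 0 < w y) {x₀ : Ω}
    (hmax : ∀ y, w y ≤ w x₀) [IsProbabilityMeasure (q.withDensity fun y => ENNReal.ofReal (w y))]
    (Khat : Kernel (Ω × Ω) (Ω × Ω)) [IsMarkovKernel Khat]
    (hK : ∀ z : Ω × Ω, Khat z = (q.prod (volume : Measure unitInterval)).map (fun p : Ω × unitInterval =>
      ((if (p.2 : ℝ) * w z.1 ≤ w p.1 then p.1 else z.1), (if (p.2 : ℝ) * w z.2 ≤ w p.1 then p.1 else z.2))))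
    (ν : Measure (Ω × Ω)) [IsProbabilityMeasure ν] {f : Ω → ℝ} (hf : Measurable f) (k : ℕ)
    (hZm : ∀ j, Measurable (Z j))
    (hlaw : ∀ j, μ.map (Z j) = Kernel.trajMeasure (X := fun _ : ℕ => Ω × Ω) ν
      (fun n : ℕ => Khat.comap (fun h : (i : ↥(Finset.Iic n)) → Ω × Ω => h ⟨n, Finset.mem_Iic.2 le_rfl⟩)
        (measurable_pi_apply _))) (j : ℕ) :
    AEStronglyMeasurable (fun z : ℕ → Ω × Ω => f ((z k).2) + ∑' n, (f ((z (k + n)).1) - f ((z (k + n)).2))) (μ.map (Z j)) ∧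
    IdentDistrib (fun ω => f ((Z j ω k).2) + ∑' n, (f ((Z j ω (k + n)).1) - f ((Z j ω (k + n)).2)))
      (fun ω => f ((Z 0 ω k).2) + ∑' n, (f ((Z 0 ω (k + n)).1) - f ((Z 0 ω (k + n)).2))) μ μ := by
  have hw : Measurable w := Fact.out
  have hHasm' : ∀ j, AEStronglyMeasurable
      (fun z : ℕ → Ω × Ω => f ((z k).2) + ∑' n, (f ((z (k + n)).1) - f ((z (k + n)).2))) (μ.map (Z j)) := fun j => by
    rw [hlaw j]; exact crnLag_untruncated_aestronglyMeasurable hw hw0 hmax Khat hK ν hf k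
  refine ⟨hHasm' j, (hHasm' j).aemeasurable.comp_measurable (hZm j), (hHasm' 0).aemeasurable.comp_measurable (hZm 0), ?_⟩
  change μ.map ((fun z : ℕ → Ω × Ω => f ((z k).2) + ∑' n, (f ((z (k + n)).1) - f ((z (k + n)).2))) ∘ Z j) =
    μ.map ((fun z : ℕ → Ω × Ω => f ((z k).2) + ∑' n, (f ((z (k + n)).1) - f ((z (k + n)).2))) ∘ Z 0)
  rw [← AEMeasurable.map_map_of_aemeasurable (hHasm' j).aemeasurable (hZm j).aemeasurable,
    ← AEMeasurable.map_map_of_aemeasurable (hHasm' 0).aemeasurable (hZm 0).aemeasurable, hlaw j, hlaw 0]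

omit [IsProbabilityMeasure μ] in
/-- Mutually independent pair streams give mutually independent untruncated estimates (a fixed measurable modification of the
a.e.-defined statistic). [ours, bookkeeping] -/
theorem crnLag_untruncated_replicas_iIndepFun [MeasurableEq Ω] [Fact (Measurable w)] (hw0 : ∀ y, 0 < w y) {x₀ : Ω}
    (hmax : ∀ y, w y ≤ w x₀) [IsProbabilityMeasure (q.withDensity fun y => ENNReal.ofReal (w y))]
    (Khat : Kernel (Ω × Ω) (Ω × Ω)) [IsMarkovKernel Khat]
    (hK : ∀ z : Ω × Ω, Khat z = (q.prod (volume : Measure unitInterval)).map (fun p : Ω × unitInterval =>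
      ((if (p.2 : ℝ) * w z.1 ≤ w p.1 then p.1 else z.1), (if (p.2 : ℝ) * w z.2 ≤ w p.1 then p.1 else z.2))))
    (ν : Measure (Ω × Ω)) [IsProbabilityMeasure ν] {f : Ω → ℝ} (hf : Measurable f) (k : ℕ)
    (hZm : ∀ j, Measurable (Z j))
    (hlaw : ∀ j, μ.map (Z j) = Kernel.trajMeasure (X := fun _ : ℕ => Ω × Ω) ν
      (fun n : ℕ => Khat.comap (fun h : (i : ↥(Finset.Iic n)) → Ω × Ω => h ⟨n, Finset.mem_Iic.2 le_rfl⟩)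
        (measurable_pi_apply _))) (hind : iIndepFun Z μ) :
    iIndepFun (fun j ω => f ((Z j ω k).2) + ∑' n, (f ((Z j ω (k + n)).1) - f ((Z j ω (k + n)).2))) μ := by
  have hw : Measurable w := Fact.out
  obtain ⟨g, hgm, hgae⟩ := crnLag_untruncated_aestronglyMeasurable hw hw0 hmax Khat hK ν hf k
  have hg : iIndepFun (fun j ω => g (Z j ω)) μ := hind.comp (fun _ => g) fun _ => hgm.measurable
  refine hg.congr (fun j => ?_)
  have hae : (fun z : ℕ → Ω × Ω => f ((z k).2) + ∑' n, (f ((z (k + n)).1) - f ((z (k + n)).2))) =ᵐ[μ.map (Z j)] g := by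
    rw [hlaw j]; exact hgae
  exact (ae_eq_comp (hZm j).aemeasurable hae).symm

/-- **THE CENTRAL LIMIT THEOREM FOR THE EXACTLY UNBIASED COUPLED ESTIMATOR.**  `w` measurable (a `Fact`), positive, normalised,
maximal at `x₀`; `MeasurableEq Ω`; `K̂` a CRN pair kernel; `Z_0, Z_1, …` mutually independent pair streams, each distributed as the
pair chain from ONE initial coupling `ν̂` one update ahead; `a ≤ f ≤ c` measurable.  Then
`(√R)⁻¹·(Σ_{j<R} H_k(Z_j) − R·π f)` converges in distribution to `N(0, Var H_k(Z_0))` — CENTRED AT `π f` ITSELF.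
[ours — Mathlib's CLT applied] -/
theorem crnLag_untruncated_replicas_clt [MeasurableEq Ω] [Fact (Measurable w)] (hw0 : ∀ y, 0 < w y) {x₀ : Ω}
    (hmax : ∀ y, w y ≤ w x₀) [IsProbabilityMeasure (q.withDensity fun y => ENNReal.ofReal (w y))]
    (Khat : Kernel (Ω × Ω) (Ω × Ω)) [IsMarkovKernel Khat]
    (hK : ∀ z : Ω × Ω, Khat z = (q.prod (volume : Measure unitInterval)).map (fun p : Ω × unitInterval =>
      ((if (p.2 : ℝ) * w z.1 ≤ w p.1 then p.1 else z.1), (if (p.2 : ℝ) * w z.2 ≤ w p.1 then p.1 else z.2))))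
    (ν : Measure (Ω × Ω)) [IsProbabilityMeasure ν] (hlag : ν.map Prod.fst = (ν.map Prod.snd).bind (indepMH q w))
    {f : Ω → ℝ} (hf : Measurable f) {a c : ℝ} (ha : ∀ x, a ≤ f x) (hc : ∀ x, f x ≤ c) (k : ℕ)
    (hZm : ∀ j, Measurable (Z j))
    (hlaw : ∀ j, μ.map (Z j) = Kernel.trajMeasure (X := fun _ : ℕ => Ω × Ω) ν
      (fun n : ℕ => Khat.comap (fun h : (i : ↥(Finset.Iic n)) → Ω × Ω => h ⟨n, Finset.mem_Iic.2 le_rfl⟩)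
        (measurable_pi_apply _)))
    (hind : iIndepFun Z μ)
    (hY : HasLaw Y (gaussianReal 0
      (Var[fun ω => f ((Z 0 ω k).2) + ∑' n, (f ((Z 0 ω (k + n)).1) - f ((Z 0 ω (k + n)).2)); μ]).toNNReal) P') :
    TendstoInDistribution
      (fun (R : ℕ) ω => (√(R : ℝ))⁻¹ *
        (∑ j ∈ range R, (f ((Z j ω k).2) + ∑' n, (f ((Z j ω (k + n)).1) - f ((Z j ω (k + n)).2))) -
          R * ∫ x, f x ∂(q.withDensity fun y => ENNReal.ofReal (w y))))
      atTop Y (fun _ => μ) P' := by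
  have hHasm' := fun j => (crnLag_untruncated_replicas_identDistrib hw0 hmax Khat hK ν hf k hZm hlaw j).1
  have hident := fun j => (crnLag_untruncated_replicas_identDistrib hw0 hmax Khat hK ν hf k hZm hlaw j).2
  have hindep := crnLag_untruncated_replicas_iIndepFun hw0 hmax Khat hK ν hf k hZm hlaw hind
  have hX2 : MemLp (fun ω => f ((Z 0 ω k).2) + ∑' n, (f ((Z 0 ω (k + n)).1) - f ((Z 0 ω (k + n)).2))) 2 μ :=
    memLp_crnLag_untruncated_replica hw0 hmax Khat hK ν hf ha hc k hZm (hlaw 0)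
  have hmean : μ[fun ω => f ((Z 0 ω k).2) + ∑' n, (f ((Z 0 ω (k + n)).1) - f ((Z 0 ω (k + n)).2))] =
      ∫ x, f x ∂(q.withDensity fun y => ENNReal.ofReal (w y)) := by
    have h1 : μ[fun ω => f ((Z 0 ω k).2) + ∑' n, (f ((Z 0 ω (k + n)).1) - f ((Z 0 ω (k + n)).2))] =
        ∫ z, (f ((z k).2) + ∑' n, (f ((z (k + n)).1) - f ((z (k + n)).2))) ∂(μ.map (Z 0)) :=
      (integral_map (hZm 0).aemeasurable (hHasm' 0)).symm
    rw [h1, hlaw 0]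
    have hYi : Integrable (fun z : ℕ → Ω × Ω => f ((z k).2))
        (Kernel.trajMeasure (X := fun _ : ℕ => Ω × Ω) ν
          (fun n : ℕ => Khat.comap (fun h : (i : ↥(Finset.Iic n)) → Ω × Ω => h ⟨n, Finset.mem_Iic.2 le_rfl⟩)
            (measurable_pi_apply _))) :=
      integrable_of_bounded _ (hf.comp (measurable_snd.comp (measurable_pi_apply k))) (fun z =>
        abs_le_max_abs_abs (ha _) (hc _))
    have hTi : Integrable (fun z : ℕ → Ω × Ω => ∑' n, (f ((z (k + n)).1) - f ((z (k + n)).2)))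
        (Kernel.trajMeasure (X := fun _ : ℕ => Ω × Ω) ν
          (fun n : ℕ => Khat.comap (fun h : (i : ↥(Finset.Iic n)) → Ω × Ω => h ⟨n, Finset.mem_Iic.2 le_rfl⟩)
            (measurable_pi_apply _))) := by
      have h := (crnLag_untruncated_memLp_two hw0 hmax Khat hK ν hf ha hc k).integrable one_le_two
      refine (h.sub hYi).congr (ae_of_all _ fun z => ?_)
      simp only [Pi.sub_apply, add_sub_cancel_left]
    rw [integral_add hYi hTi]
    exact crnLag_unbiased hw0 hmax Khat hK ν hlag hf ha hc k
  have h := tendstoInDistribution_inv_sqrt_mul_sum_sub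
    (X := fun j ω => f ((Z j ω k).2) + ∑' n, (f ((Z j ω (k + n)).1) - f ((Z j ω (k + n)).2))) hY hX2 hindep hident
  rw [hmean] at h
  exact h

/-- **The limiting variance of the unbiased estimator is at most `Var_π f + r^k(c − a)²(2W² + W + 1)`** (it equals
`E(H_k − π f)²` by exact unbiasedness). [ours] -/
theorem crnLag_untruncated_replica_variance_le [MeasurableEq Ω] [Fact (Measurable w)] (hw0 : ∀ y, 0 < w y) {x₀ : Ω}
    (hmax : ∀ y, w y ≤ w x₀) [IsProbabilityMeasure (q.withDensity fun y => ENNReal.ofReal (w y))]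
    (Khat : Kernel (Ω × Ω) (Ω × Ω)) [IsMarkovKernel Khat]
    (hK : ∀ z : Ω × Ω, Khat z = (q.prod (volume : Measure unitInterval)).map (fun p : Ω × unitInterval =>
      ((if (p.2 : ℝ) * w z.1 ≤ w p.1 then p.1 else z.1), (if (p.2 : ℝ) * w z.2 ≤ w p.1 then p.1 else z.2))))
    (ν : Measure (Ω × Ω)) [IsProbabilityMeasure ν] {f : Ω → ℝ} (hf : Measurable f) {a c : ℝ} (ha : ∀ x, a ≤ f x)
    (hc : ∀ x, f x ≤ c) (k : ℕ) (hZm : ∀ j, Measurable (Z j))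
    (hlaw : ∀ j, μ.map (Z j) = Kernel.trajMeasure (X := fun _ : ℕ => Ω × Ω) ν
      (fun n : ℕ => Khat.comap (fun h : (i : ↥(Finset.Iic n)) → Ω × Ω => h ⟨n, Finset.mem_Iic.2 le_rfl⟩)
        (measurable_pi_apply _))) :
    Var[fun ω => f ((Z 0 ω k).2) + ∑' n, (f ((Z 0 ω (k + n)).1) - f ((Z 0 ω (k + n)).2)); μ] ≤
      ∫ y, (f y - ∫ x, f x ∂(q.withDensity fun y => ENNReal.ofReal (w y))) ^ 2
          ∂(q.withDensity fun y => ENNReal.ofReal (w y)) +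
        (1 - (w x₀)⁻¹) ^ k * (c - a) ^ 2 * (2 * w x₀ ^ 2 + w x₀ + 1) := by
  have hw : Measurable w := Fact.out
  set m := ∫ x, f x ∂(q.withDensity fun y => ENNReal.ofReal (w y)) with hm
  have hX2 : MemLp (fun ω => f ((Z 0 ω k).2) + ∑' n, (f ((Z 0 ω (k + n)).1) - f ((Z 0 ω (k + n)).2))) 2 μ :=
    memLp_crnLag_untruncated_replica hw0 hmax Khat hK ν hf ha hc k hZm (hlaw 0)
  have h1 := integral_sub_const_sq hX2 m
  have hHasm : AEStronglyMeasurable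
      (fun z : ℕ → Ω × Ω => (f ((z k).2) + ∑' n, (f ((z (k + n)).1) - f ((z (k + n)).2)) - m) ^ 2)
      (μ.map (Z 0)) := by
    rw [hlaw 0]
    exact (crnLag_untruncated_sq_integrable hw0 hmax Khat hK ν hf ha hc k).aestronglyMeasurable
  have h2 : ∫ ω, (f ((Z 0 ω k).2) + ∑' n, (f ((Z 0 ω (k + n)).1) - f ((Z 0 ω (k + n)).2)) - m) ^ 2 ∂μ ≤
      ∫ y, (f y - m) ^ 2 ∂(q.withDensity fun y => ENNReal.ofReal (w y)) +
        (1 - (w x₀)⁻¹) ^ k * (c - a) ^ 2 * (2 * w x₀ ^ 2 + w x₀ + 1) := by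
    have := crnLag_untruncated_sq_le hw0 hmax Khat hK ν hf ha hc k
    rw [← hlaw 0, integral_map (hZm 0).aemeasurable hHasm] at this
    exact this
  nlinarith [sq_nonneg (μ[fun ω => f ((Z 0 ω k).2) + ∑' n, (f ((Z 0 ω (k + n)).1) - f ((Z 0 ω (k + n)).2))] - m)]

/-! ## §3 The strong law: the grand mean of coupled estimates is consistent for `π f` itself -/

/-- **THE STRONG LAW FOR THE EXACTLY UNBIASED COUPLED ESTIMATOR**: pairwise independent pair streams (mutually independent here)
from ONE initial coupling one update ahead ⇒ `H̄_R → π f` almost surely as `R → ∞` — CONSISTENT FOR THE TARGET VALUE ITSELF, from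
every starting law (Mathlib's `strong_law_ae`, Etemadi's version, applied). [ours] -/
theorem crnLag_untruncated_replicas_strongLaw [MeasurableEq Ω] [Fact (Measurable w)] (hw0 : ∀ y, 0 < w y) {x₀ : Ω}
    (hmax : ∀ y, w y ≤ w x₀) [IsProbabilityMeasure (q.withDensity fun y => ENNReal.ofReal (w y))]
    (Khat : Kernel (Ω × Ω) (Ω × Ω)) [IsMarkovKernel Khat]
    (hK : ∀ z : Ω × Ω, Khat z = (q.prod (volume : Measure unitInterval)).map (fun p : Ω × unitInterval =>
      ((if (p.2 : ℝ) * w z.1 ≤ w p.1 then p.1 else z.1), (if (p.2 : ℝ) * w z.2 ≤ w p.1 then p.1 else z.2))))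
    (ν : Measure (Ω × Ω)) [IsProbabilityMeasure ν] (hlag : ν.map Prod.fst = (ν.map Prod.snd).bind (indepMH q w))
    {f : Ω → ℝ} (hf : Measurable f) {a c : ℝ} (ha : ∀ x, a ≤ f x) (hc : ∀ x, f x ≤ c) (k : ℕ)
    (hZm : ∀ j, Measurable (Z j))
    (hlaw : ∀ j, μ.map (Z j) = Kernel.trajMeasure (X := fun _ : ℕ => Ω × Ω) ν
      (fun n : ℕ => Khat.comap (fun h : (i : ↥(Finset.Iic n)) → Ω × Ω => h ⟨n, Finset.mem_Iic.2 le_rfl⟩)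
        (measurable_pi_apply _)))
    (hind : iIndepFun Z μ) :
    ∀ᵐ ω ∂μ, Tendsto (fun R : ℕ => (R : ℝ)⁻¹ *
        ∑ j ∈ range R, (f ((Z j ω k).2) + ∑' n, (f ((Z j ω (k + n)).1) - f ((Z j ω (k + n)).2))))
      atTop (𝓝 (∫ x, f x ∂(q.withDensity fun y => ENNReal.ofReal (w y)))) := by
  have hHasm' := fun j => (crnLag_untruncated_replicas_identDistrib hw0 hmax Khat hK ν hf k hZm hlaw j).1
  have hident := fun j => (crnLag_untruncated_replicas_identDistrib hw0 hmax Khat hK ν hf k hZm hlaw j).2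
  have hindep := crnLag_untruncated_replicas_iIndepFun hw0 hmax Khat hK ν hf k hZm hlaw hind
  have hint : Integrable (fun ω => f ((Z 0 ω k).2) + ∑' n, (f ((Z 0 ω (k + n)).1) - f ((Z 0 ω (k + n)).2))) μ :=
    (memLp_crnLag_untruncated_replica hw0 hmax Khat hK ν hf ha hc k hZm (hlaw 0)).integrable one_le_two
  have hmean : μ[fun ω => f ((Z 0 ω k).2) + ∑' n, (f ((Z 0 ω (k + n)).1) - f ((Z 0 ω (k + n)).2))] =
      ∫ x, f x ∂(q.withDensity fun y => ENNReal.ofReal (w y)) := by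
    rw [← integral_map (hZm 0).aemeasurable (hHasm' 0), hlaw 0]
    have hYi : Integrable (fun z : ℕ → Ω × Ω => f ((z k).2))
        (Kernel.trajMeasure (X := fun _ : ℕ => Ω × Ω) ν
          (fun n : ℕ => Khat.comap (fun h : (i : ↥(Finset.Iic n)) → Ω × Ω => h ⟨n, Finset.mem_Iic.2 le_rfl⟩)
            (measurable_pi_apply _))) :=
      integrable_of_bounded _ (hf.comp (measurable_snd.comp (measurable_pi_apply k))) (fun z =>
        abs_le_max_abs_abs (ha _) (hc _))
    have hTi : Integrable (fun z : ℕ → Ω × Ω => ∑' n, (f ((z (k + n)).1) - f ((z (k + n)).2)))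
        (Kernel.trajMeasure (X := fun _ : ℕ => Ω × Ω) ν
          (fun n : ℕ => Khat.comap (fun h : (i : ↥(Finset.Iic n)) → Ω × Ω => h ⟨n, Finset.mem_Iic.2 le_rfl⟩)
            (measurable_pi_apply _))) := by
      have h := (crnLag_untruncated_memLp_two hw0 hmax Khat hK ν hf ha hc k).integrable one_le_two
      refine (h.sub hYi).congr (ae_of_all _ fun z => ?_)
      simp only [Pi.sub_apply, add_sub_cancel_left]
    rw [integral_add hYi hTi]
    exact crnLag_unbiased hw0 hmax Khat hK ν hlag hf ha hc k
  have h := strong_law_ae (fun j ω => f ((Z j ω k).2) + ∑' n, (f ((Z j ω (k + n)).1) - f ((Z j ω (k + n)).2))) hint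
    (fun i j hij => hindep.indepFun hij) hident
  rw [hmean] at h
  filter_upwards [h] with ω hω
  simpa only [smul_eq_mul] using hω

end Replicas

end Summit.Ventures.LatticeQCDFlow.Exactness

end
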